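import Summits.BirchSwinnertonDyer.BirchSwinnertonDyer.Theses.ByReductionTypeAtTwo
import Summits.BirchSwinnertonDyer.BirchSwinnertonDyer.Theorems.ByReductionTypeAtTwoAdditiveLowerHalfDoors
import HarnessLib

/-!
# K4 crux `AdditiveRankZeroAtTwo` (item 19098), child C3″ `AdditivePotGoodLowerHalfAtTwo` of the v2.2 split:
# the first SUPPLY pointer — C3″ BY NAME from PRINT + READINGS + the good siblings + C1″ + C2″ (BY NAME) +
# the one-sided over-K lower halves (hKClow on the defect-≥3 block, hQKlow on the quadratic sub-class)

Cell `bsd-2adic`, seat `bsd-2adic-addL2x` GEN 12 (after gate5's split of 19098). HONEST FRAMING: a re-keying of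
GEN 11's p629807 `AddKatoTwo.addPotGoodLower_two_of_kato_of_lowerOverK` to the child decls of the split; closes
nothing (the over-K lower halves `hKClow`/`hQKlow` and Murty–Murty are displayed hypotheses); BSD is not proved by
any of this. Theorems only.
-/

set_option autoImplicit false
set_option linter.dupNamespace false

noncomputable section

open scoped Classical

namespace Summit.BirchSwinnertonDyer.BirchSwinnertonDyer.Theorems.AddKatoTwo

open WeierstrassCurve Literature.NumberTheory.EllipticCurves
  Literature.NumberTheory.EllipticCurves.ModularForms
  Literature.NumberTheory.EllipticCurves.Kato2004
  Literature.NumberTheory.IwasawaTheory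
  Literature.NumberTheory.EllipticCurves.Rank1Residual
  Literature.NumberTheory.EllipticCurves.Rank1Residual.Typed
  Summit.BirchSwinnertonDyer.Rank1Residual.X5.AddTwoL2
  Summit.BirchSwinnertonDyer.Rank1Residual.AdditivePotMult
  Summit.BirchSwinnertonDyer.BirchSwinnertonDyer.Theses.ByReductionTypeAtTwo

/-- **C3″ `AdditivePotGoodLowerHalfAtTwo` BY NAME from its supply roads** (GEN 11 p629807 re-keyed to the split):
PRINT {GZK, modularity ×2, Milne any-model, Hoffstein–Luo, Murty–Murty@2, Lim@2, FW, Cassels, CT} + READINGS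
{hSharp, `exists_memberHullInputs_two`} + the GOOD siblings `GoodOrdinaryRankZeroAtTwo`, `SupersingularRankZeroAtTwo`
+ the children C1″ `FineSelmerConjAAtTwoAdditivePotGood` and C2″ `AdditivePotGoodReducibleRestAtTwo` BY NAME + the
ONE-SIDED over-K lower halves `hKClow` (defect ≥ 3, inert quadratic K) and `hQKlow` (quadratic sub-class, semistabilising
K) ⟹ the EISENSTEIN half over ℚ on the whole additive potentially-good class. [cite: Kato2004, Thm. 12.5, §13, Thm. 14.5]
[cite: Milne1972ArithmeticAV, Thm. 1] [cite: MurtyMurty1997, Ch. 6 Thm. 1.2] -/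
theorem additivePotGoodLowerHalfAtTwo_of_children_of_lowerOverK
    (hGZK : rank_eq_analyticRank_of_analyticRank_le_one) (hmod : hasEntireLFunction_rat) (hmodN : exists_isNewformOf)
    (hMilneC : Milne1972.bsdQuotient_baseChange_quadratic_anyModel)
    (hHL : HoffsteinLuo1997_exists_twist_L_one_ne_zero)
    (hMM : murtyMurty_exists_twist_ne_zero_prescribedAtTwo)
    (hLim2 : Lim2017.thm35_at_two_fineSelmerDual_moduleFinite_of_classicalMuVanishes_of_le_divisionField_four)
    (hFW : ferreroWashington1979_classicalMuVanishes)
    (hCassels : bsdRHS_eq_of_isIsogenous) (hCT : exists_casselsTate_pairing (K := ℚ))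
    (hSharp : Kato2004.rankZero_padicValNat_sha_add_padicValNat_tamagawa_le_at_two_of_irreducible_of_fineSelmerDual_fg)
    (hin : Kato2004.exists_memberHullInputs_two)
    (hOrd : GoodOrdinaryRankZeroAtTwo) (hSS : SupersingularRankZeroAtTwo)
    (hAna : FineSelmerConjAAtTwoAdditivePotGood) (hRest : AdditivePotGoodReducibleRestAtTwo)
    (hKClow : ∀ (W : WeierstrassCurve ℚ) [W.IsElliptic] [W.IsGloballyMinimal],
      ¬ W.HasCM → W.analyticRank = 0 → DefectAtLeastThree W →
      ∀ (K : Type) [Field K] [NumberField K], Module.finrank ℚ K = 2 → TwoInert K →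
        (W.quadraticTwist (NumberField.discr K : ℚ)).entireLFunction 1 ≠ 0 →
        MissingLowerBoundOverCAt (W.baseChange K) 2)
    (hQKlow : ∀ (W : WeierstrassCurve ℚ) [W.IsElliptic] [W.IsGloballyMinimal], ¬ W.HasCM → W.analyticRank = 0 →
      Addv W 2 → 0 ≤ padicValRat 2 W.j → ∀ (K : Type) [Field K] [NumberField K], Module.finrank ℚ K = 2 →
        SemistableTwistAtTwo W K → (W.quadraticTwist (NumberField.discr K : ℚ)).entireLFunction 1 ≠ 0 →
          MissingLowerBoundOverCAt (W.baseChange K) 2) :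
    AdditivePotGoodLowerHalfAtTwo := by
  intro W _ _ hcm hr hadd hj
  exact addPotGoodLower_two_of_kato_of_lowerOverK hGZK hmod hmodN hMilneC hHL hMM hLim2 hFW hCassels hCT hSharp hin
    hOrd hSS hAna hRest hKClow hQKlow W hcm hr hadd hj

end Summit.BirchSwinnertonDyer.BirchSwinnertonDyer.Theorems.AddKatoTwo

end
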